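import Literature.MathematicalPhysics.QuantumFieldTheory.Balaban1983to89.Node00.TwoRunSiteWindow

/-!
# NODE 00 — COMPONENTS OF A LARGE-FIELD REGION ON THE TORUS AND THE COMPONENT-WISE FORGIVING WINDOW ON THE TWO-RUN SITE KEY: above the floor `c`,
# every connected component of the large-field region `Z_j = Λ_jᶜ` that MEETS the floor region `Z_c` is filled («forgiven»: old structure together with
# its growth and with whatever merged into it), the levels `1 ≤ j ≤ c` are forgotten; what stays keyed above the floor are the components DISJOINT from
# `Z_c` — births in the window not absorbed by old structure

Cell `pub-ymgap`, YM-PLAN Track A (HUMAN RULING D-0062; width push D-0149); seat `pub-ymgap-dag-n20-d` (R134 (a) N20 NE7b s3) gen 29 — continuation of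
`Node00/TwoRunSite{Transport,Key,Lift,Persistence,Window}` (p561554 ∕ p570161 ∕ p575738 ∕ p583644 ∕ p608088).  [III] = [Balaban1988Convergent], [LF-I] =
[Balaban1989LargeFieldI], [LF-II] = [Balaban1989LargeFieldII].

WHY (dag-n20-w2 g3 LOCATED, pub-ymgap INBOX l.31349, CONCURRED by this seat l.31377).  The LEVEL window `windowKey c` of `Node00/TwoRunSiteWindow` forgets the index
ENTRIES at the levels `≤ c`, not the STRUCTURE born there: the (2.1) chain is cumulative (`Chain21.Λ_subset ∕ Ω_succ_subset`, [III] (2.1) p.254), so a large-field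
region born at level `1` is a hole of `Λ_j` at EVERY later level and two histories differing by an old birth keep distinct window keys.  Print, on the contrary, lets an
old region leave the description: its pending component grows by layers each step ([LF-I] p.177 l.17–18 «Each renormalization step adds at least ten layers of
MR_k-cubes»; [LF-II] p.384 `S(Z) = Z′^{∼10}`), merges with what it touches ([LF-II] (1.85) p.386: components `Z_j^{(n)}` and new regions `Z_{j+1}^{(i)}` «joined together
into the one component of Z_{j+1}»), and is resummed by 𝐑 when (i), (ii) hold.  The key-level object that forgives an old region TOGETHER WITH ITS GROWTH AND ITS MERGERS,
definable by combinatorics alone, is component-wise: at a kept level `j > c` fill every connected component of `Z_j` that meets the floor region `Z_c`.  A floor-UNION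
variant (`Λ_j ∪ Z_c`, n20-w2's `forgiveKey`) fills `Z_c` but not its growth ring `Z_j ∖ Z_c`, hence merges only histories whose old regions do not grow — located there.
WHAT IS TYPED.  §1 (any type, any «touching» relation `τ`): `LinkedIn τ S` (a `τ`-step INSIDE `S`), `ConnIn τ S` (its reflexive-transitive closure = connected inside
`S`), `absorbed τ R S := {z ∈ S | ∃ z₀ ∈ S ∩ R, ConnIn τ S z₀ z}` (the union of the components of `S` meeting `R`), `forgive τ R Λ := Λ ∪ absorbed τ R Λᶜ` (fill them);
algebra: monotone∕idempotent facts, `forgive τ ∅ Λ = Λ`, `forgive τ R univ = univ`, `forgive_eq_univ_iff` (every point of the hole is connected inside the hole to the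
reference region), `forgive τ univ Λ = univ`.  §2 the torus: `SiteTouch` on `Fin 4 → ZMod n` («sup-distance ≤ 1», coordinatewise difference in `{0, 1, −1}`;
reflexive, symmetric — Bałaban's «intersect, or touch each other», [LF-II] p.386).  §3 the key: `forgiveKeyComp c x` := both sequences, levels `1 ≤ j ≤ c ↦ T_η`, levels
`j > c ↦ forgive SiteTouch (x.2 c)ᶜ (x.i j)` for `1 ≤ c` (floor `0`: nothing to forgive, `= x`); `forgiveKeyComp_zero`, entries below∕above the floor, ★ the window is
UNDER it (`windowKey c x ≤ forgiveKeyComp c x` entrywise and `windowKey c (forgiveKeyComp c x) = forgiveKeyComp c x`), ★ persistence: `KeyOldLargeField jcut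
(forgiveKeyComp c x) ↔ ∃ j, c < j ≤ jcut ∧` «some point of `Z_j` is NOT connected inside `Z_j` to `Z_c`» (an UN-ABSORBED BIRTH in the window) for `1 ≤ c`, ★ the
saturated floor forgives everything (`x.2 c = ∅ → ¬ KeyOldLargeField jcut (forgiveKeyComp c x)`), and the all-small key is untouched; §4 σ-form `forgiveKeyCompSigma` (a
floor per step) = a key-reading VALUE for `YMDAG.UVSplit.crOfRecord₁₃KAt`.
HONEST — WHAT THIS IS NOT.  Not Bałaban's (1.80): the pending window `K(Z)` there is SIZE-dependent (a huge region pends longer) and 𝐑 applies only under (i), (ii);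
the forgiving window forgives EVERY floor-old component regardless of size and readiness — the card's (AC) booking of over-aged huge regions must sit on top (a bad-key
reading), it is not built in.  Site-level touching is used for connectivity (two cube unions touch iff some of their sites touch); no cube geometry is developed here.  No
weight, no estimate; NE7 ∕ NE7b ∕ NE7c NOT PRINTED for `d = 4` and NOT proved; nothing of Bałaban's asserted; no node count moves (typed 28∕28 · discharged 5∕27); no
`sorry`, no `axiom`, no `instance`, no `notation`; one finite four-torus programme at fixed `ε` — NOT ℝ⁴, NOT OS, NOT a mass gap, NOT the Clay problem.
-/

noncomputable section

open scoped BigOperators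

namespace Literature.MathematicalPhysics.QuantumFieldTheory.Balaban1983to89.Node00

open T4Continuum B14.Eq213MaximalDomains B15Eq112TorusCover B14DomainGeom B14.Eq218Concrete

/-! ## §1  Components of a set under a touching relation; absorbing the components that meet a reference region -/

section Components

variable {α : Type*} (τ : α → α → Prop)

/-- One touching step INSIDE the set `S`: both endpoints lie in `S` and touch. [cite: Balaban1989LargeFieldII, (1.84) p.386 (bookkeeping)] -/
def LinkedIn (S : Set α) (z z' : α) : Prop :=
  z ∈ S ∧ z' ∈ S ∧ τ z z'

/-- **CONNECTED INSIDE `S`**: the reflexive-transitive closure of touching steps inside `S` (print's «connected domain»: «the corresponding domains intersect, or touch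
each other», chained). [cite: Balaban1989LargeFieldII, (1.84) p.386 (bookkeeping)] -/
def ConnIn (S : Set α) : α → α → Prop :=
  Relation.ReflTransGen (LinkedIn τ S)

/-- Connected inside `S` is reflexive. [cite: Balaban1989LargeFieldII, (1.84) p.386 (bookkeeping)] -/
theorem connIn_refl (S : Set α) (z : α) : ConnIn τ S z z :=
  Relation.ReflTransGen.refl

/-- A chain inside `S` that moves at all ENDS in `S`. [cite: Balaban1989LargeFieldII, (1.84) p.386 (bookkeeping)] -/
theorem ConnIn.mem_of_ne {S : Set α} {z z' : α} (h : ConnIn τ S z z') (hne : z ≠ z') : z' ∈ S := by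
  induction h with
  | refl => exact (hne rfl).elim
  | tail _ hl _ => exact hl.2.1

/-- A chain inside `S` from a point of `S` stays in `S`. [cite: Balaban1989LargeFieldII, (1.84) p.386 (bookkeeping)] -/
theorem ConnIn.mem {S : Set α} {z z' : α} (h : ConnIn τ S z z') (hz : z ∈ S) : z' ∈ S := by
  by_cases hne : z = z'
  · exact hne ▸ hz
  · exact h.mem_of_ne τ hne

/-- Chains compose. [cite: Balaban1989LargeFieldII, (1.84) p.386 (bookkeeping)] -/
theorem ConnIn.trans {S : Set α} {z z' z'' : α} (h : ConnIn τ S z z') (h' : ConnIn τ S z' z'') : ConnIn τ S z z'' :=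
  Relation.ReflTransGen.trans h h'

/-- Connectivity is monotone in the ambient set. [cite: Balaban1989LargeFieldII, (1.84) p.386 (bookkeeping)] -/
theorem ConnIn.mono {S T : Set α} (hST : S ⊆ T) {z z' : α} (h : ConnIn τ S z z') : ConnIn τ T z z' := by
  induction h with
  | refl => exact connIn_refl τ T _
  | tail _ hl ih => exact Relation.ReflTransGen.tail ih ⟨hST hl.1, hST hl.2.1, hl.2.2⟩

/-- **THE ABSORBED PART of `S` relative to the reference region `R`**: the points of `S` connected INSIDE `S` to a point of `S ∩ R` — the union of the connected components
of `S` that MEET `R` (old components together with everything merged into them). [cite: Balaban1989LargeFieldII, (1.85) p.386 (bookkeeping)] -/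
def absorbed (R S : Set α) : Set α :=
  {z | z ∈ S ∧ ∃ z₀, z₀ ∈ S ∧ z₀ ∈ R ∧ ConnIn τ S z₀ z}

/-- Membership in the absorbed part. [cite: Balaban1989LargeFieldII, (1.85) p.386 (bookkeeping)] -/
theorem mem_absorbed_iff (R S : Set α) (z : α) : z ∈ absorbed τ R S ↔ z ∈ S ∧ ∃ z₀, z₀ ∈ S ∧ z₀ ∈ R ∧ ConnIn τ S z₀ z :=
  Iff.rfl

/-- The absorbed part lies in `S`. [cite: Balaban1989LargeFieldII, (1.85) p.386 (bookkeeping)] -/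
theorem absorbed_subset (R S : Set α) : absorbed τ R S ⊆ S := fun _ hz => hz.1

/-- The reference points of `S` are absorbed. [cite: Balaban1989LargeFieldII, (1.85) p.386 (bookkeeping)] -/
theorem inter_subset_absorbed (R S : Set α) : S ∩ R ⊆ absorbed τ R S := fun z hz => ⟨hz.1, z, hz.1, hz.2, connIn_refl τ S z⟩

/-- No reference region, nothing absorbed. [cite: Balaban1989LargeFieldII, (1.85) p.386 (bookkeeping)] -/
theorem absorbed_empty_left (S : Set α) : absorbed τ ∅ S = ∅ :=
  Set.eq_empty_of_forall_notMem fun _ ⟨_, _, _, h0, _⟩ => h0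

/-- The whole space as reference absorbs all of `S` (every point is its own reference). [cite: Balaban1989LargeFieldII, (1.85) p.386 (bookkeeping)] -/
theorem absorbed_univ_left (S : Set α) : absorbed τ Set.univ S = S :=
  Set.Subset.antisymm (absorbed_subset τ _ S) fun z hz => ⟨hz, z, hz, Set.mem_univ z, connIn_refl τ S z⟩

/-- The absorbed part is closed under touching steps inside `S` (it is a union of components). [cite: Balaban1989LargeFieldII, (1.85) p.386 (bookkeeping)] -/
theorem mem_absorbed_of_connIn {R S : Set α} {z z' : α} (hz : z ∈ absorbed τ R S) (h : ConnIn τ S z z') : z' ∈ absorbed τ R S := by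
  obtain ⟨hzS, z₀, hz₀S, hz₀R, hc⟩ := hz
  exact ⟨h.mem τ hzS, z₀, hz₀S, hz₀R, hc.trans τ h⟩

/-- **FORGIVING**: fill, in the small-field entry `Λ`, the components of its hole `Λᶜ` that meet the reference region `R`. [cite: Balaban1989LargeFieldII, (1.85) p.386 (bookkeeping)] -/
def forgive (R Λ : Set α) : Set α :=
  Λ ∪ absorbed τ R Λᶜ

/-- Forgiving only ENLARGES the small-field entry. [cite: Balaban1989LargeFieldII, (1.85) p.386 (bookkeeping)] -/
theorem subset_forgive (R Λ : Set α) : Λ ⊆ forgive τ R Λ :=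
  Set.subset_union_left

/-- Membership: in `Λ`, or in a component of the hole meeting `R`. [cite: Balaban1989LargeFieldII, (1.85) p.386 (bookkeeping)] -/
theorem mem_forgive_iff (R Λ : Set α) (z : α) : z ∈ forgive τ R Λ ↔ z ∈ Λ ∨ z ∈ absorbed τ R Λᶜ :=
  Iff.rfl

/-- No reference region: nothing forgiven. [cite: Balaban1989LargeFieldII, (1.85) p.386 (bookkeeping)] -/
theorem forgive_empty_left (Λ : Set α) : forgive τ ∅ Λ = Λ := by
  rw [forgive, absorbed_empty_left, Set.union_empty]

/-- Nothing to forgive in the whole lattice. [cite: Balaban1989LargeFieldII, (1.85) p.386 (bookkeeping)] -/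
theorem forgive_univ_right (R : Set α) : forgive τ R Set.univ = Set.univ :=
  Set.eq_univ_of_univ_subset (subset_forgive τ R _)

/-- The whole space as reference forgives everything. [cite: Balaban1989LargeFieldII, (1.85) p.386 (bookkeeping)] -/
theorem forgive_univ_left (Λ : Set α) : forgive τ Set.univ Λ = Set.univ := by
  rw [forgive, absorbed_univ_left, Set.union_compl_self]

/-- ★ **WHAT SURVIVES FORGIVING**: the forgiven entry is the whole lattice iff EVERY point of the hole `Λᶜ` is connected inside the hole to a reference point of the hole —
i.e. every component of the large-field region meets `R`; a component DISJOINT from `R` survives as a large field. [cite: Balaban1989LargeFieldII, (1.85) p.386 (bookkeeping)] -/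
theorem forgive_eq_univ_iff (R Λ : Set α) : forgive τ R Λ = Set.univ ↔ ∀ z, z ∉ Λ → ∃ z₀, z₀ ∉ Λ ∧ z₀ ∈ R ∧ ConnIn τ Λᶜ z₀ z := by
  rw [Set.eq_univ_iff_forall]
  refine forall_congr' fun z => ?_
  rw [mem_forgive_iff, mem_absorbed_iff]
  constructor
  · rintro (hz | ⟨_, z₀, hz₀, hR, hc⟩) hzΛ
    · exact (hzΛ hz).elim
    · exact ⟨z₀, hz₀, hR, hc⟩
  · intro h
    by_cases hz : z ∈ Λ
    · exact Or.inl hz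
    · obtain ⟨z₀, hz₀, hR, hc⟩ := h hz
      exact Or.inr ⟨hz, z₀, hz₀, hR, hc⟩

/-- If the hole lies inside the reference region, everything is forgiven. [cite: Balaban1989LargeFieldII, (1.85) p.386 (bookkeeping)] -/
theorem forgive_eq_univ_of_compl_subset {R Λ : Set α} (h : Λᶜ ⊆ R) : forgive τ R Λ = Set.univ :=
  (forgive_eq_univ_iff τ R Λ).2 fun z hz => ⟨z, hz, h hz, connIn_refl τ _ z⟩

end Components

/-! ## §2  Touching on the torus: sup-distance at most one -/

section Torus

variable {P : Params} {j : ℕ}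

/-- **TOUCHING SITES** of the torus `T^{(j)}` (`Site P j = Fin d → ZMod (2L^{m+K−j})`): every coordinate differs by `0`, `1` or `−1` (sup-distance `≤ 1`; two unions of cubes
intersect or touch iff some of their sites touch). [cite: Balaban1989LargeFieldII, (1.84) p.386 (bookkeeping)] -/
def SiteTouch (z z' : Site P j) : Prop :=
  ∀ μ : Fin P.d, z' μ - z μ = 0 ∨ z' μ - z μ = 1 ∨ z' μ - z μ = -1

/-- Touching is reflexive. [cite: Balaban1989LargeFieldII, (1.84) p.386 (bookkeeping)] -/
theorem siteTouch_refl (z : Site P j) : SiteTouch z z := fun μ => Or.inl (sub_self (z μ))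

/-- Touching is symmetric. [cite: Balaban1989LargeFieldII, (1.84) p.386 (bookkeeping)] -/
theorem SiteTouch.symm {z z' : Site P j} (h : SiteTouch z z') : SiteTouch z' z := by
  intro μ
  have hneg : z μ - z' μ = -(z' μ - z μ) := (neg_sub (z' μ) (z μ)).symm
  rcases h μ with h0 | h1 | h2
  · exact Or.inl (by rw [hneg, h0, neg_zero])
  · exact Or.inr (Or.inr (by rw [hneg, h1]))
  · exact Or.inr (Or.inl (by rw [hneg, h2, neg_neg]))

/-- Connectivity inside a set of torus sites is symmetric. [cite: Balaban1989LargeFieldII, (1.84) p.386 (bookkeeping)] -/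
theorem connIn_siteTouch_symm {S : Set (Site P j)} {z z' : Site P j} (h : ConnIn SiteTouch S z z') : ConnIn SiteTouch S z' z := by
  induction h with
  | refl => exact connIn_refl _ S _
  | tail _ hl ih => exact Relation.ReflTransGen.head ⟨hl.2.1, hl.1, hl.2.2.symm⟩ ih

end Torus

/-! ## §3  The component-wise forgiving window on a key -/

section Key

variable (F : T4Family) {Kc : ℕ}

/-- The FLOOR REFERENCE REGION of a key at floor `c`: the large-field region `Z_c = Λ_cᶜ` at the floor level, and NOTHING at floor `0` (the conventional level `0` carries no
structure). [cite: Balaban1989LargeFieldII, (1.80) p.384 (bookkeeping)] -/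
def floorRegion (c : ℕ) (x : SiteSeqKey F Kc) : Set (Site (F.P Kc) 0) :=
  if c = 0 then ∅ else (x.2 c)ᶜ

/-- Floor `0`: no reference region. [cite: Balaban1989LargeFieldII, (1.80) p.384 (bookkeeping)] -/
@[simp] theorem floorRegion_zero (x : SiteSeqKey F Kc) : floorRegion F 0 x = ∅ := if_pos rfl

/-- Floor `c ≥ 1`: the floor-level large-field region. [cite: Balaban1989LargeFieldII, (1.80) p.384 (bookkeeping)] -/
theorem floorRegion_of_one_le {c : ℕ} (hc : 1 ≤ c) (x : SiteSeqKey F Kc) : floorRegion F c x = (x.2 c)ᶜ :=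
  if_neg (Nat.one_le_iff_ne_zero.mp hc)

/-- **THE COMPONENT-WISE FORGIVING WINDOW WITH FLOOR `c`**: the entries at the levels `1 ≤ j ≤ c` are forgotten (whole lattice), and in every kept entry the components of its
hole that meet the floor region `Z_c` are filled — old structure with its growth and its mergers leaves the key; un-absorbed births in the window stay.
[cite: Balaban1989LargeFieldII, (1.85) p.386 (bookkeeping); Balaban1988Convergent, p.244 (bookkeeping)] -/
def forgiveKeyComp (c : ℕ) (x : SiteSeqKey F Kc) : SiteSeqKey F Kc :=
  (fun j => if 1 ≤ j ∧ j ≤ c then Set.univ else forgive SiteTouch (floorRegion F c x) (x.1 j),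
   fun j => if 1 ≤ j ∧ j ≤ c then Set.univ else forgive SiteTouch (floorRegion F c x) (x.2 j))

/-- **FLOOR `0` IS THE FULL KEY**. [cite: Balaban1988Convergent, (2.18) p.257 (bookkeeping)] -/
theorem forgiveKeyComp_zero (x : SiteSeqKey F Kc) : forgiveKeyComp F 0 x = x := by
  refine Prod.ext (funext fun j => ?_) (funext fun j => ?_)
  · show (if 1 ≤ j ∧ j ≤ 0 then Set.univ else forgive SiteTouch (floorRegion F 0 x) (x.1 j)) = x.1 j
    rw [if_neg fun h => absurd (h.1.trans h.2) (by decide), floorRegion_zero, forgive_empty_left]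
  · show (if 1 ≤ j ∧ j ≤ 0 then Set.univ else forgive SiteTouch (floorRegion F 0 x) (x.2 j)) = x.2 j
    rw [if_neg fun h => absurd (h.1.trans h.2) (by decide), floorRegion_zero, forgive_empty_left]

/-- At or below the floor: forgotten (second entry). [cite: Balaban1989LargeFieldII, (1.80) p.384 (bookkeeping)] -/
theorem forgiveKeyComp_snd_of_le (c : ℕ) (x : SiteSeqKey F Kc) {j : ℕ} (h1 : 1 ≤ j) (hj : j ≤ c) : (forgiveKeyComp F c x).2 j = Set.univ :=
  if_pos ⟨h1, hj⟩

/-- At or below the floor: forgotten (first entry). [cite: Balaban1989LargeFieldII, (1.80) p.384 (bookkeeping)] -/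
theorem forgiveKeyComp_fst_of_le (c : ℕ) (x : SiteSeqKey F Kc) {j : ℕ} (h1 : 1 ≤ j) (hj : j ≤ c) : (forgiveKeyComp F c x).1 j = Set.univ :=
  if_pos ⟨h1, hj⟩

/-- The conventional level `0` is above no floor clause: its entry is forgiven too (second entry). [cite: Balaban1988Convergent, (2.18) p.257 (bookkeeping)] -/
theorem forgiveKeyComp_snd_zero_level (c : ℕ) (x : SiteSeqKey F Kc) : (forgiveKeyComp F c x).2 0 = forgive SiteTouch (floorRegion F c x) (x.2 0) := by
  show (if 1 ≤ 0 ∧ 0 ≤ c then Set.univ else forgive SiteTouch (floorRegion F c x) (x.2 0)) = _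
  rw [if_neg]
  exact fun h => absurd h.1 (by decide)

/-- Level `0`, first entry. [cite: Balaban1988Convergent, (2.18) p.257 (bookkeeping)] -/
theorem forgiveKeyComp_fst_zero_level (c : ℕ) (x : SiteSeqKey F Kc) : (forgiveKeyComp F c x).1 0 = forgive SiteTouch (floorRegion F c x) (x.1 0) := by
  show (if 1 ≤ 0 ∧ 0 ≤ c then Set.univ else forgive SiteTouch (floorRegion F c x) (x.1 0)) = _
  rw [if_neg]
  exact fun h => absurd h.1 (by decide)

/-- Above the floor: the forgiven entry (second entry). [cite: Balaban1989LargeFieldII, (1.85) p.386 (bookkeeping)] -/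
theorem forgiveKeyComp_snd_of_lt (c : ℕ) (x : SiteSeqKey F Kc) {j : ℕ} (hj : c < j) :
    (forgiveKeyComp F c x).2 j = forgive SiteTouch (floorRegion F c x) (x.2 j) :=
  if_neg fun h => absurd h.2 (not_le.mpr hj)

/-- Above the floor: the forgiven entry (first entry). [cite: Balaban1989LargeFieldII, (1.85) p.386 (bookkeeping)] -/
theorem forgiveKeyComp_fst_of_lt (c : ℕ) (x : SiteSeqKey F Kc) {j : ℕ} (hj : c < j) :
    (forgiveKeyComp F c x).1 j = forgive SiteTouch (floorRegion F c x) (x.1 j) :=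
  if_neg fun h => absurd h.2 (not_le.mpr hj)

/-- ★ **THE LEVEL WINDOW LIES UNDER THE FORGIVING WINDOW** (second entries): at every level the forgiving window's small-field entry contains the level window's.
[cite: Balaban1989LargeFieldII, (1.80) p.384 (bookkeeping)] -/
theorem windowKey_snd_subset_forgiveKeyComp_snd (c : ℕ) (x : SiteSeqKey F Kc) (j : ℕ) : (windowKey c x).2 j ⊆ (forgiveKeyComp F c x).2 j := by
  by_cases h : 1 ≤ j ∧ j ≤ c
  · rw [forgiveKeyComp_snd_of_le F c x h.1 h.2]
    exact Set.subset_univ _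
  · rw [windowKey_snd, if_neg h]
    show x.2 j ⊆ (forgiveKeyComp F c x).2 j
    by_cases h0 : j = 0
    · subst h0
      rw [forgiveKeyComp_snd_zero_level]
      exact subset_forgive _ _ _
    · rw [forgiveKeyComp_snd_of_lt F c x (not_le.mp fun hjc => h ⟨Nat.one_le_iff_ne_zero.mpr h0, hjc⟩)]
      exact subset_forgive _ _ _

/-- The forgiving window is INVISIBLE to the level window: forgetting the levels `≤ c` after forgiving changes nothing. [cite: Balaban1989LargeFieldII, (1.80) p.384 (bookkeeping)] -/
theorem windowKey_forgiveKeyComp (c : ℕ) (x : SiteSeqKey F Kc) : windowKey c (forgiveKeyComp F c x) = forgiveKeyComp F c x := by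
  refine Prod.ext (funext fun j => ?_) (funext fun j => ?_)
  · by_cases h : 1 ≤ j ∧ j ≤ c
    · rw [windowKey_fst_of_le c _ h.1 h.2, forgiveKeyComp_fst_of_le F c x h.1 h.2]
    · rw [windowKey_fst, if_neg h]
  · by_cases h : 1 ≤ j ∧ j ≤ c
    · rw [windowKey_snd_of_le c _ h.1 h.2, forgiveKeyComp_snd_of_le F c x h.1 h.2]
    · rw [windowKey_snd, if_neg h]

/-- ★ **PERSISTENCE ON THE FORGIVING WINDOW = AN UN-ABSORBED BIRTH IN THE WINDOW** (floor `c ≥ 1`): the forgiven key carries an old large-field region at a level `≤ jcut` iff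
at some level `c < j ≤ jcut` some point of the large-field region `Z_j` is NOT connected inside `Z_j` to a point of the floor region `Z_c` — a component of `Z_j` disjoint
from `Z_c`. [cite: Balaban1989LargeFieldII, (1.85) p.386 (bookkeeping); Balaban1989LargeFieldII, (1.80) p.384 (bookkeeping)] -/
theorem keyOldLargeField_forgiveKeyComp_iff {c : ℕ} (hc : 1 ≤ c) (jcut : ℕ) (x : SiteSeqKey F Kc) :
    KeyOldLargeField jcut (forgiveKeyComp F c x) ↔
      ∃ j, c < j ∧ j ≤ jcut ∧ ∃ z, z ∉ x.2 j ∧ ∀ z₀, z₀ ∉ x.2 j → z₀ ∉ x.2 c → ¬ ConnIn SiteTouch (x.2 j)ᶜ z₀ z := by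
  constructor
  · rintro ⟨j, h1, hj, hne⟩
    by_cases hjc : j ≤ c
    · exact (hne (forgiveKeyComp_snd_of_le F c x h1 hjc)).elim
    · have hlt : c < j := not_le.mp hjc
      rw [forgiveKeyComp_snd_of_lt F c x hlt, floorRegion_of_one_le F hc, Ne, forgive_eq_univ_iff] at hne
      push Not at hne
      obtain ⟨z, hz, hz'⟩ := hne
      exact ⟨j, hlt, hj, z, hz, fun z₀ h₀ h₀c => hz' z₀ h₀ h₀c⟩
  · rintro ⟨j, hcj, hj, z, hz, hz'⟩
    refine ⟨j, Nat.one_le_of_lt hcj, hj, ?_⟩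
    rw [forgiveKeyComp_snd_of_lt F c x hcj, floorRegion_of_one_le F hc, Ne, forgive_eq_univ_iff]
    push Not
    exact ⟨z, hz, fun z₀ h₀ h₀c => hz' z₀ h₀ h₀c⟩

/-- ★ **A SATURATED FLOOR FORGIVES EVERYTHING**: if the floor-level large-field region is the whole lattice (`Λ_c = ∅`), the forgiving window carries NO old region at any cut —
the «every block large» extreme reads to the all-small key above the floor. [cite: Balaban1989LargeFieldII, (1.85) p.386 (bookkeeping)] -/
theorem not_keyOldLargeField_forgiveKeyComp_of_floor_empty {c : ℕ} (hc : 1 ≤ c) {x : SiteSeqKey F Kc} (hx : x.2 c = ∅) (jcut : ℕ) :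
    ¬ KeyOldLargeField jcut (forgiveKeyComp F c x) := by
  rintro ⟨j, h1, hj, hne⟩
  by_cases hjc : j ≤ c
  · exact hne (forgiveKeyComp_snd_of_le F c x h1 hjc)
  · refine hne ?_
    rw [forgiveKeyComp_snd_of_lt F c x (not_le.mp hjc), floorRegion_of_one_le F hc, hx, Set.compl_empty]
    exact forgive_univ_left _ _

/-- The all-small entries are untouched: a level with no large field stays so. [cite: Balaban1989LargeFieldI, (0.2) p.176 (bookkeeping)] -/
theorem forgiveKeyComp_snd_eq_univ_of_eq_univ (c : ℕ) (x : SiteSeqKey F Kc) {j : ℕ} (hj : x.2 j = Set.univ) (h1 : 1 ≤ j) : (forgiveKeyComp F c x).2 j = Set.univ := by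
  by_cases hjc : j ≤ c
  · exact forgiveKeyComp_snd_of_le F c x h1 hjc
  · rw [forgiveKeyComp_snd_of_lt F c x (not_le.mp hjc), hj]
    exact forgive_univ_right _ _

/-- Coarsening never CREATES bad keys: an old region on the forgiving window is an old region on the key, at a level above the floor.
[cite: Balaban1989LargeFieldII, (1.80) p.384 (bookkeeping)] -/
theorem keyOldLargeField_of_forgiveKeyComp {c jcut : ℕ} {x : SiteSeqKey F Kc} (h : KeyOldLargeField jcut (forgiveKeyComp F c x)) :
    ∃ j, c < j ∧ j ≤ jcut ∧ x.2 j ≠ Set.univ := by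
  obtain ⟨j, h1, hj, hne⟩ := h
  by_cases hjc : j ≤ c
  · exact (hne (forgiveKeyComp_snd_of_le F c x h1 hjc)).elim
  · refine ⟨j, not_le.mp hjc, hj, fun hu => hne ?_⟩
    exact forgiveKeyComp_snd_eq_univ_of_eq_univ F c x hu h1

end Key

/-! ## §4  The σ-packed forgiving window: one floor per step -/

section Sigma

variable (F : T4Family) {K₀ : ℕ}

/-- **THE σ-PACKED COMPONENT-WISE FORGIVING WINDOW** with a floor `c K` per step — a key-reading VALUE for `YMDAG.UVSplit.crOfRecord₁₃KAt`.
[cite: Balaban1989LargeFieldII, (1.85) p.386 (bookkeeping)] -/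
def forgiveKeyCompSigma (c : ℕ → ℕ) (x : Σ K, SiteSeqKey F (K₀ + K)) : Σ K, SiteSeqKey F (K₀ + K) :=
  ⟨x.1, forgiveKeyComp F (c x.1) x.2⟩

/-- The step component is kept. [cite: Balaban1988Convergent, (2.18) p.257 (bookkeeping)] -/
@[simp] theorem forgiveKeyCompSigma_fst (c : ℕ → ℕ) (x : Σ K, SiteSeqKey F (K₀ + K)) : (forgiveKeyCompSigma F c x).1 = x.1 := rfl

/-- On a packed key. [cite: Balaban1989LargeFieldII, (1.85) p.386 (bookkeeping)] -/
theorem forgiveKeyCompSigma_mk (c : ℕ → ℕ) (K : ℕ) (y : SiteSeqKey F (K₀ + K)) : forgiveKeyCompSigma F c ⟨K, y⟩ = ⟨K, forgiveKeyComp F (c K) y⟩ := rfl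

/-- Floor `0` at every step is the identity. [cite: Balaban1988Convergent, (2.18) p.257 (bookkeeping)] -/
theorem forgiveKeyCompSigma_zero (x : Σ K, SiteSeqKey F (K₀ + K)) : forgiveKeyCompSigma F (fun _ => 0) x = x := by
  obtain ⟨K, y⟩ := x
  rw [forgiveKeyCompSigma_mk, forgiveKeyComp_zero]

/-- The window after the forgiving window is the forgiving window (σ-form). [cite: Balaban1989LargeFieldII, (1.80) p.384 (bookkeeping)] -/
theorem windowKeySigma_forgiveKeyCompSigma (c : ℕ → ℕ) (x : Σ K, SiteSeqKey F (K₀ + K)) :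
    windowKeySigma F c (forgiveKeyCompSigma F c x) = forgiveKeyCompSigma F c x := by
  obtain ⟨K, y⟩ := x
  rw [forgiveKeyCompSigma_mk, windowKeySigma_mk, windowKey_forgiveKeyComp]

/-- A saturated floor at a step books nothing there, whatever the policy. [cite: Balaban1989LargeFieldII, (1.85) p.386 (bookkeeping)] -/
theorem not_keyOldLargeField_forgiveKeyCompSigma_of_floor_empty {c : ℕ → ℕ} (jcut : ℕ → ℕ) (x : Σ K, SiteSeqKey F (K₀ + K)) (hc : 1 ≤ c x.1)
    (hx : x.2.2 (c x.1) = ∅) : ¬ KeyOldLargeField (jcut x.1) (forgiveKeyCompSigma F c x).2 :=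
  not_keyOldLargeField_forgiveKeyComp_of_floor_empty F hc hx (jcut x.1)

end Sigma

end Literature.MathematicalPhysics.QuantumFieldTheory.Balaban1983to89.Node00

end
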